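import Summits.QuantumFields.GaugeBoot.BootstrapArchimedean
import Summits.QuantumFields.GaugeBoot.BootstrapSymmetryReduction
import Summits.QuantumFields.GaugeBoot.InvariantMeanZd
import Literature.MathematicalPhysics.QuantumLattice.LatticeGaugeDLRSymmetry
import HarnessLib

/-!
# Translation averaging of bootstrap functionals on the infinite lattice `ℤ^d` (gauge-boot, L1/L4 supplement)

HONEST FRAMING (cell `pub-gaugeboot`, page 1 of every file): the venture produces certified bounds
on lattice expectations at stated coupling, gauge group, dimension and torus size; NOT a mass gap,
NOT a continuum limit, NOT a string tension; NOT Yang–Mills-summit-bearing (barriers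
`FixedCouplingUltralocality`, `PerturbativeInvisibility`). Structural; it certifies no number.

## Content (any compact gauge group, any unitary `r`, translation-covariant local actions on `ℤ^d`)

On the torus the symmetry group is finite and the Reynolds operator is a finite average
(`BootstrapSymmetryReduction.avgFunctional`). On the INFINITE lattice `ℤ^d` — the setting of
Anderson–Kruczenski and Kazakov–Zheng — the translation group is infinite; its Reynolds operator on
bootstrap functionals is the invariant mean `zdMean` of `InvariantMeanZd.lean` applied to the
orbit `v ↦ φ (x ∘ τ_v)`:

* `translateFun v φ = φ ∘ τ_v^*` (`τ_v = relabelCM (edgeShift v)`, `(U ∘ τ_v)(x, i) = U (x + v, i)`,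
  `= configShift (-v) U`, `relabelCM_edgeShift_eq_configShift`); `relabelCM_edgeShift_comp`; ★ `IsBootstrapFeasible.translateFun` — translates of level-`V`
  feasible functionals are feasible (translation-covariant local actions, translation-stable `V`);
  `wilsonBoundaryAction_single_relabelCM_edgeShift` — the one-link Wilson boundary actions ARE
  translation covariant;
* `orbitBounded φ` — the submodule of observables whose translation orbit under `φ` is bounded
  (translation stable, `comp_mem_orbitBounded`); `translationAvg φ` — a linear functional on ALL
  observables which on `orbitBounded φ` is the invariant mean of the orbit
  (`translationAvg_apply`; linear extension elsewhere); ★ `translationAvg_comp` — it is translation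
  INVARIANT on `orbitBounded φ`; `translationAvg_eq_of_forall_eq`, `translationAvg_mem_Icc` — it
  lies between the infimum and the supremum of the orbit;
* ★★ `isBootstrapFeasible_translationAvg` — if `φ` is level-`V` feasible and the squares of the
  test functions have bounded orbits, the average is level-`V` feasible (normalisation and
  positivity pass to the mean; each row element is killed by every translate);
* ★★ `certDomain_le_orbitBounded` — at word level `n` EVERY element of the certificate domain
  (words of length `≤ 2n` and rows) has a bounded orbit under a feasible `φ`: `1` is an order unit
  (`BootstrapArchimedean`) and the translates of `φ` are feasible;
* ★★★ `exists_translationInvariant_feasible` — THE REYNOLDS OPERATOR OF `ℤ^d`: every level-`n`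
  solution `φ` of the word-truncated bootstrap on `ℤ^d` has a level-`n` solution `ψ` which is
  translation invariant on the whole level-`n` certificate domain and whose value at each `x` there
  is the invariant mean of `v ↦ φ (x ∘ τ_v)` — in particular between `inf_v` and `sup_v` of the
  translates' values, and equal to `φ x` when these are all equal.

What this is NOT: the mean is not canonical (another invariant mean gives another `ψ`); nothing
here compares the OPTIMAL values of the reduced and the plain SDP at fixed level (see
`BootstrapTranslationReductionZd.lean` for what can be said); no rates.

References: P. Anderson, M. Kruczenski, Nucl. Phys. B 921 (2017) §3; V. Kazakov, Z. Zheng,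
arXiv:2203.11360 §3 (Wilson loops modulo lattice symmetries); K. Gatermann, P. A. Parrilo, J. Pure
Appl. Algebra 192 (2004) 95, Thm 3.3 (Reynolds operator for invariant SDPs); M. M. Day (1957)
(amenability). Folklore.
-/

noncomputable section

open MeasureTheory Filter Topology NormedSpace
open Literature.MathematicalPhysics.QuantumFieldTheory (LatticeRep)
open Literature.MathematicalPhysics.QuantumLattice

namespace Summit.QuantumFields.GaugeBoot

/-! ## Translations of `ℤ^d` as relabellings -/

section Translate

variable {d : ℕ} {G : Type*} [Group G] [TopologicalSpace G]

omit [Group G] in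
/-- **Composition of translations**: `τ_a^* ∘ τ_v^* = τ_{a+v}^*` on configurations
(`relabelCM (edgeShift a) (relabelCM (edgeShift v) U) = U ∘ edgeShift v ∘ edgeShift a`). -/
theorem relabelCM_edgeShift_comp (a v : Fin d → ℤ) :
    (relabelCM (G := G) (edgeShift a)).comp (relabelCM (edgeShift v)) =
      relabelCM (G := G) (edgeShift (a + v)) := by
  ext U e
  simp only [ContinuousMap.comp_apply, relabelCM_apply, edgeShift_apply, add_assoc]

omit [Group G] in
/-- Translating an observable twice. -/
theorem comp_relabelCM_edgeShift_comp (x : C(LGConfig d G, ℝ)) (a v : Fin d → ℤ) :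
    (x.comp (relabelCM (G := G) (edgeShift a))).comp (relabelCM (edgeShift v)) =
      x.comp (relabelCM (G := G) (edgeShift (a + v))) := by
  rw [ContinuousMap.comp_assoc, relabelCM_edgeShift_comp]

/-- **The translate of a functional**: `translateFun v φ x = φ (x ∘ τ_v)`. [folklore] -/
abbrev translateFun (v : Fin d → ℤ) (φ : C(LGConfig d G, ℝ) →ₗ[ℝ] ℝ) :
    C(LGConfig d G, ℝ) →ₗ[ℝ] ℝ :=
  φ ∘ₗ (ContinuousMap.compRightAlgHom ℝ ℝ (relabelCM (G := G) (edgeShift v))).toLinearMap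

omit [Group G] in
/-- `translateFun` evaluated. -/
@[simp] theorem translateFun_apply (v : Fin d → ℤ) (φ : C(LGConfig d G, ℝ) →ₗ[ℝ] ℝ)
    (x : C(LGConfig d G, ℝ)) :
    translateFun v φ x = φ (x.comp (relabelCM (G := G) (edgeShift v))) := rfl

omit [Group G] in
/-- **The relabelling by `edgeShift v` is the configuration shift by `-v`** of
`LatticeGaugeDLR` (`(U ∘ τ_v)(x, i) = U (x + v, i) = (θ_{-v} U)(x, i)`). -/
theorem relabelCM_edgeShift_eq_configShift [MeasurableSpace G] (v : Fin d → ℤ) (U : LGConfig d G) :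
    relabelCM (G := G) (edgeShift v) U = configShift (-v) U := by
  funext e'
  simp only [relabelCM_apply, edgeShift_apply, configShift_apply, sub_neg_eq_add]

/-- **The one-link Wilson boundary actions are translation covariant**:
`S_e (U ∘ τ_v) = S_{e + v} U`. -/
theorem wilsonBoundaryAction_single_relabelCM_edgeShift [MeasurableSpace G] {N : ℕ}
    (ρ : G →* Matrix (Fin N) (Fin N) ℂ) (v : Fin d → ℤ) (e : ZdEdge d) (U : LGConfig d G) :
    wilsonBoundaryAction ρ {e} (relabelCM (G := G) (edgeShift v) U) =
      wilsonBoundaryAction ρ {edgeShift v e} U := by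
  have hU : relabelCM (G := G) (edgeShift v) U = configShift (-v) U :=
    relabelCM_edgeShift_eq_configShift v U
  have hΛ : ({e} : Finset (ZdEdge d)) = ({edgeShift v e} : Finset (ZdEdge d)).map (edgeShift (-v)).toEmbedding := by
    rw [Finset.map_singleton]
    simp only [Equiv.toEmbedding_apply, edgeShift_apply, add_neg_cancel_right]
  rw [hU, hΛ]
  exact wilsonBoundaryAction_configShift ρ (-v) {edgeShift v e} U

variable (r : LatticeRep G) {K : Type*} {k : K → ℝ → G} {S : ZdEdge d → LGConfig d G → ℝ} {β : ℝ}

/-- ★ **Translates of feasible functionals are feasible** (translation-covariant local actions,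
translation-stable test set). [cite: GatermannParrilo2004, Thm 3.3 (the group maps feasible points
to feasible points)] -/
theorem IsBootstrapFeasible.translateFun
    (hS : ∀ (v : Fin d → ℤ) (e : ZdEdge d) (U : LGConfig d G),
      S e (relabelCM (G := G) (edgeShift v) U) = S (edgeShift v e) U)
    {V : Set C(LGConfig d G, ℝ)}
    (hV : ∀ (v : Fin d → ℤ), ∀ x ∈ V, x.comp (relabelCM (G := G) (edgeShift v)) ∈ V)
    {φ : C(LGConfig d G, ℝ) →ₗ[ℝ] ℝ} (hφ : IsBootstrapFeasible r k S β V φ) (v : Fin d → ℤ) :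
    IsBootstrapFeasible r k S β V (translateFun v φ) :=
  hφ.comp_relabel r (edgeShift v) (hS v) (hV v)

/-- The word truncation is translation stable. -/
theorem comp_relabelCM_edgeShift_mem_wordTruncation (n : ℕ) (v : Fin d → ℤ) {x : C(LGConfig d G, ℝ)}
    (hx : x ∈ wordTruncation (ι := ZdEdge d) r n) :
    x.comp (relabelCM (G := G) (edgeShift v)) ∈ wordTruncation (ι := ZdEdge d) r n :=
  comp_relabelCM_mem_wordTruncation r _ hx

end Translate

/-! ## The orbit-bounded observables and the translation average -/

section Average

variable {d : ℕ} {G : Type*} [TopologicalSpace G] (φ : C(LGConfig d G, ℝ) →ₗ[ℝ] ℝ)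

/-- **The orbit of `x` under `φ`**: `v ↦ φ (x ∘ τ_v)`. -/
def orbitFn (x : C(LGConfig d G, ℝ)) : (Fin d → ℤ) → ℝ := fun v => translateFun v φ x

/-- `orbitFn` evaluated. -/
@[simp] theorem orbitFn_apply (x : C(LGConfig d G, ℝ)) (v : Fin d → ℤ) :
    orbitFn φ x v = φ (x.comp (relabelCM (G := G) (edgeShift v))) := rfl

/-- The orbit is additive in the observable. -/
theorem orbitFn_add (x y : C(LGConfig d G, ℝ)) : orbitFn φ (x + y) = orbitFn φ x + orbitFn φ y :=
  funext fun v => map_add (translateFun v φ) x y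

/-- The orbit is homogeneous in the observable. -/
theorem orbitFn_smul (c : ℝ) (x : C(LGConfig d G, ℝ)) : orbitFn φ (c • x) = c • orbitFn φ x :=
  funext fun v => map_smul (translateFun v φ) c x

/-- **The orbit of a translate is the translated orbit.** -/
theorem orbitFn_comp (a : Fin d → ℤ) (x : C(LGConfig d G, ℝ)) :
    orbitFn φ (x.comp (relabelCM (G := G) (edgeShift a))) = fun v => orbitFn φ x (a + v) := by
  funext v
  simp only [orbitFn_apply, comp_relabelCM_edgeShift_comp]

/-- **The orbit-bounded observables**: those `x` for which `v ↦ φ (x ∘ τ_v)` is bounded. A linear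
subspace. [folklore] -/
def orbitBounded : Submodule ℝ C(LGConfig d G, ℝ) where
  carrier := {x | ∃ M : ℝ, ∀ v : Fin d → ℤ, |orbitFn φ x v| ≤ M}
  zero_mem' := ⟨0, fun v => by simp⟩
  add_mem' := by
    rintro x y ⟨Mx, hx⟩ ⟨My, hy⟩
    refine ⟨Mx + My, fun v => ?_⟩
    rw [orbitFn_add, Pi.add_apply]
    exact (abs_add_le _ _).trans (add_le_add (hx v) (hy v))
  smul_mem' := by
    rintro c x ⟨M, hx⟩
    refine ⟨|c| * M, fun v => ?_⟩
    rw [orbitFn_smul, Pi.smul_apply, smul_eq_mul, abs_mul]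
    exact mul_le_mul_of_nonneg_left (hx v) (abs_nonneg c)

/-- Membership in `orbitBounded`, unfolded. -/
theorem mem_orbitBounded_iff {x : C(LGConfig d G, ℝ)} :
    x ∈ orbitBounded φ ↔ ∃ M : ℝ, ∀ v : Fin d → ℤ, |φ (x.comp (relabelCM (G := G) (edgeShift v)))| ≤ M :=
  Iff.rfl

/-- **The orbit-bounded observables are translation stable.** -/
theorem comp_mem_orbitBounded {x : C(LGConfig d G, ℝ)} (hx : x ∈ orbitBounded φ) (a : Fin d → ℤ) :
    x.comp (relabelCM (G := G) (edgeShift a)) ∈ orbitBounded φ := by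
  obtain ⟨M, hM⟩ := hx
  refine ⟨M, fun v => ?_⟩
  rw [orbitFn_comp]
  exact hM _

/-- The invariant mean of the orbit, as a linear functional on the orbit-bounded observables. -/
def meanOnOrbitBounded : orbitBounded φ →ₗ[ℝ] ℝ where
  toFun x := zdMean d (orbitFn φ x)
  map_add' x y := by
    obtain ⟨Mx, hx⟩ := x.2
    obtain ⟨My, hy⟩ := y.2
    simp only [Submodule.coe_add, orbitFn_add]
    exact zdMean_add hx hy
  map_smul' c x := by
    obtain ⟨M, hx⟩ := x.2
    simp only [Submodule.coe_smul, orbitFn_smul, RingHom.id_apply, smul_eq_mul]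
    exact zdMean_smul hx c

/-- **The translation average of `φ`**: a linear functional on all observables which on the
orbit-bounded ones is the invariant mean of the orbit `v ↦ φ (x ∘ τ_v)` (a linear extension
elsewhere). [cite: GatermannParrilo2004, proof of Thm 3.3 (Reynolds operator), with the finite
average replaced by an invariant mean of `ℤ^d`] -/
def translationAvg : C(LGConfig d G, ℝ) →ₗ[ℝ] ℝ :=
  Classical.choose (LinearMap.exists_extend (meanOnOrbitBounded φ))

/-- ★ **On orbit-bounded observables the average is the invariant mean of the orbit.** -/
theorem translationAvg_apply {x : C(LGConfig d G, ℝ)} (hx : x ∈ orbitBounded φ) :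
    translationAvg φ x = zdMean d (orbitFn φ x) := by
  have h := LinearMap.congr_fun (Classical.choose_spec (LinearMap.exists_extend (meanOnOrbitBounded φ)))
    ⟨x, hx⟩
  unfold translationAvg
  simpa [meanOnOrbitBounded] using h

/-- ★ **The average is translation invariant** on the orbit-bounded observables. -/
theorem translationAvg_comp {x : C(LGConfig d G, ℝ)} (hx : x ∈ orbitBounded φ) (a : Fin d → ℤ) :
    translationAvg φ (x.comp (relabelCM (G := G) (edgeShift a))) = translationAvg φ x := by
  obtain ⟨M, hM⟩ := id hx
  rw [translationAvg_apply φ (comp_mem_orbitBounded φ hx a), translationAvg_apply φ hx, orbitFn_comp]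
  exact zdMean_shift' hM a

/-- **A constant orbit is averaged to its value.** -/
theorem translationAvg_eq_of_forall_eq {x : C(LGConfig d G, ℝ)} {c : ℝ}
    (h : ∀ v : Fin d → ℤ, φ (x.comp (relabelCM (G := G) (edgeShift v))) = c) :
    translationAvg φ x = c := by
  have hx : x ∈ orbitBounded φ := ⟨|c|, fun v => by rw [orbitFn_apply, h v]⟩
  rw [translationAvg_apply φ hx]
  exact zdMean_eq_of_forall_eq h

/-- **On invariant observables the average agrees with `φ`.** -/
theorem translationAvg_eq_self_of_invariant {x : C(LGConfig d G, ℝ)}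
    (h : ∀ v : Fin d → ℤ, φ (x.comp (relabelCM (G := G) (edgeShift v))) = φ x) :
    translationAvg φ x = φ x :=
  translationAvg_eq_of_forall_eq φ h

/-- ★ **Squeeze**: the average lies between any bounds of the orbit. -/
theorem translationAvg_mem_Icc {x : C(LGConfig d G, ℝ)} {lo hi : ℝ}
    (hlo : ∀ v : Fin d → ℤ, lo ≤ φ (x.comp (relabelCM (G := G) (edgeShift v))))
    (hhi : ∀ v : Fin d → ℤ, φ (x.comp (relabelCM (G := G) (edgeShift v))) ≤ hi) :
    translationAvg φ x ∈ Set.Icc lo hi := by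
  have hx : x ∈ orbitBounded φ := by
    refine ⟨max |lo| |hi|, fun v => abs_le.2 ⟨?_, ?_⟩⟩
    · have h1 : -|lo| ≤ lo := neg_abs_le lo
      have h2 : |lo| ≤ max |lo| |hi| := le_max_left _ _
      rw [orbitFn_apply]
      linarith [hlo v]
    · rw [orbitFn_apply]
      exact (hhi v).trans ((le_abs_self hi).trans (le_max_right _ _))
  rw [translationAvg_apply φ hx]
  exact zdMean_mem_Icc hlo hhi

/-- **Positivity**: a non-negative orbit (of an orbit-bounded observable) has non-negative
average. -/
theorem translationAvg_nonneg {x : C(LGConfig d G, ℝ)} (hx : x ∈ orbitBounded φ)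
    (h : ∀ v : Fin d → ℤ, 0 ≤ φ (x.comp (relabelCM (G := G) (edgeShift v)))) :
    0 ≤ translationAvg φ x := by
  obtain ⟨M, hM⟩ := id hx
  rw [translationAvg_apply φ hx]
  exact zdMean_nonneg hM h

end Average

/-! ## Feasibility of the average -/

section Feasible

variable {d : ℕ} {G : Type*} [Group G] [TopologicalSpace G] (r : LatticeRep G)
  {K : Type*} {k : K → ℝ → G} {S : ZdEdge d → LGConfig d G → ℝ} {β : ℝ}

/-- ★★ **The translation average of a feasible functional is feasible** — level `V`,
translation-covariant local actions, translation-stable `V` — provided the squares of the test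
functions have bounded orbits (automatic at word level `n`, `certDomain_le_orbitBounded`).
Normalisation and positivity pass to the mean; each row element is annihilated by every translate
of `φ` (a constant orbit), hence by the average. [cite: GatermannParrilo2004, Thm 3.3] -/
theorem isBootstrapFeasible_translationAvg
    (hS : ∀ (v : Fin d → ℤ) (e : ZdEdge d) (U : LGConfig d G),
      S e (relabelCM (G := G) (edgeShift v) U) = S (edgeShift v e) U)
    {V : Set C(LGConfig d G, ℝ)}
    (hV : ∀ (v : Fin d → ℤ), ∀ x ∈ V, x.comp (relabelCM (G := G) (edgeShift v)) ∈ V)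
    {φ : C(LGConfig d G, ℝ) →ₗ[ℝ] ℝ} (hφ : IsBootstrapFeasible r k S β V φ)
    (hsq : ∀ w ∈ V, w * w ∈ orbitBounded φ) :
    IsBootstrapFeasible r k S β V (translationAvg φ) := by
  have hfeas : ∀ v, IsBootstrapFeasible r k S β V (translateFun v φ) := hφ.translateFun r hS hV
  refine ⟨translationAvg_eq_of_forall_eq φ fun v => (hfeas v).1, fun w hw => ?_, fun i a => ?_⟩
  · exact translationAvg_nonneg φ (hsq w hw) fun v => (hfeas v).2.1 w hw
  · obtain ⟨S', hS'm, hS'd, -⟩ := hφ.2.2 i a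
    refine ⟨S', hS'm, hS'd, fun f hf f' hf'm hf'd => ?_⟩
    have hmem : f' - β • (f * S') ∈ rowSet r k S β V :=
      ⟨i, a, f, f', S', hf, hf'm, hS'm, hS'd, hf'd, rfl⟩
    have h := translationAvg_eq_of_forall_eq φ (x := f' - β • (f * S')) (c := 0)
      fun v => (hfeas v).apply_eq_zero_of_mem_rowSet r hmem
    rwa [map_sub, map_smul, smul_eq_mul, sub_eq_zero] at h

/-- ★★ **At word level `n` the whole certificate domain has bounded orbits** under a feasible
functional: `1` is an order unit for the certificate cone on the certificate domain
(`exists_smul_one_sub_mem_certCone`) and every translate of `φ` is feasible, so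
`-t' ≤ φ (x ∘ τ_v) ≤ t` uniformly in `v`. [folklore] -/
theorem certDomain_le_orbitBounded
    (hS : ∀ (v : Fin d → ℤ) (e : ZdEdge d) (U : LGConfig d G),
      S e (relabelCM (G := G) (edgeShift v) U) = S (edgeShift v e) U)
    {n : ℕ} {φ : C(LGConfig d G, ℝ) →ₗ[ℝ] ℝ}
    (hφ : IsBootstrapFeasible r k S β (wordTruncation (ι := ZdEdge d) r n) φ) :
    certDomain r k S β n ≤ orbitBounded φ := by
  intro x hx
  obtain ⟨⟨t, ht⟩, ⟨t', ht'⟩⟩ := exists_smul_one_sub_mem_certCone r hx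
  have hfeas : ∀ v, IsBootstrapFeasible r k S β (wordTruncation (ι := ZdEdge d) r n) (translateFun v φ) :=
    hφ.translateFun r hS (comp_relabelCM_edgeShift_mem_wordTruncation r n)
  have ht'' : x - (-t') • (1 : C(LGConfig d G, ℝ)) ∈ certCone r k S β (wordTruncation (ι := ZdEdge d) r n) := by
    rwa [neg_smul, sub_neg_eq_add, add_comm]
  refine ⟨max |t| |t'|, fun v => abs_le.2 ⟨?_, ?_⟩⟩
  · have h := (hfeas v).le_apply_of_mem_certCone r ht''
    rw [orbitFn_apply]
    have h1 : t' ≤ |t'| := le_abs_self t'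
    have h2 : |t'| ≤ max |t| |t'| := le_max_right _ _
    rw [translateFun_apply] at h
    linarith
  · have h := (hfeas v).apply_le_of_mem_certCone r ht
    rw [translateFun_apply] at h
    rw [orbitFn_apply]
    exact h.trans ((le_abs_self t).trans (le_max_left _ _))

/-- ★★★ **The Reynolds operator of `ℤ^d` on the word-truncated bootstrap.** Any compact gauge
group, any unitary representation `r`, translation-covariant local actions with polynomial
derivatives, any real `β`, any word level `n`: every level-`n` feasible functional `φ` on `ℤ^d`
has a level-`n` feasible functional `ψ` which is TRANSLATION INVARIANT on the whole level-`n`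
certificate domain (all words of length `≤ 2n` and all level-`n` rows — everything the level-`n`
SDP sees), whose value at each such `x` is the invariant mean of the translates' values
`v ↦ φ (x ∘ τ_v)`: between their infimum and supremum, and equal to `φ x` whenever these are all
equal. [cite: GatermannParrilo2004, Thm 3.3 (lattice `ℤ^d`, infinite abelian symmetry group:
Reynolds operator = invariant mean)] -/
theorem exists_translationInvariant_feasible
    (hS : ∀ (v : Fin d → ℤ) (e : ZdEdge d) (U : LGConfig d G),
      S e (relabelCM (G := G) (edgeShift v) U) = S (edgeShift v e) U)
    {n : ℕ} {φ : C(LGConfig d G, ℝ) →ₗ[ℝ] ℝ}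
    (hφ : IsBootstrapFeasible r k S β (wordTruncation (ι := ZdEdge d) r n) φ) :
    ∃ ψ : C(LGConfig d G, ℝ) →ₗ[ℝ] ℝ,
      IsBootstrapFeasible r k S β (wordTruncation (ι := ZdEdge d) r n) ψ ∧
      (∀ (a : Fin d → ℤ), ∀ x ∈ certDomain r k S β n,
        ψ (x.comp (relabelCM (G := G) (edgeShift a))) = ψ x) ∧
      (∀ x ∈ certDomain r k S β n,
        ψ x = zdMean d fun v => φ (x.comp (relabelCM (G := G) (edgeShift v)))) ∧
      (∀ x ∈ certDomain r k S β n, ∀ lo hi : ℝ,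
        (∀ v : Fin d → ℤ, lo ≤ φ (x.comp (relabelCM (G := G) (edgeShift v)))) →
        (∀ v : Fin d → ℤ, φ (x.comp (relabelCM (G := G) (edgeShift v))) ≤ hi) →
          ψ x ∈ Set.Icc lo hi) ∧
      (∀ x : C(LGConfig d G, ℝ),
        (∀ v : Fin d → ℤ, φ (x.comp (relabelCM (G := G) (edgeShift v))) = φ x) → ψ x = φ x) := by
  have hdom := certDomain_le_orbitBounded r hS hφ
  refine ⟨translationAvg φ, ?_, fun a x hx => translationAvg_comp φ (hdom hx) a,
    fun x hx => translationAvg_apply φ (hdom hx), fun x _ lo hi hlo hhi =>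
      translationAvg_mem_Icc φ hlo hhi, fun x hx => translationAvg_eq_self_of_invariant φ hx⟩
  exact isBootstrapFeasible_translationAvg r hS (comp_relabelCM_edgeShift_mem_wordTruncation r n) hφ
    fun w hw => hdom (mem_certDomain_of_mem_wordTruncation r (mul_mem_wordTruncation_add r hw hw))

end Feasible

end Summit.QuantumFields.GaugeBoot

end
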